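import Summits.CriticalPhenomena.PercolationContinuityZ3.Theorems.PercNearOneGluingNoHeavyLowerTailFKCoefficientMono
import Literature.Probability.Percolation.KozmaNitzanClusterPropertyReal
import HarnessLib

/-!
# FK sub-lane: two exits of an avoided set are positively correlated given avoidance (`φ_{w,q}`, `q ≥ 1`)

Support file (`--supports stmt-CriticalPhenomena-4575`), FK sub-lane `prim-bschramm-fk-2` (gen 3); builds on p205010 (kernel theorem,
internal audit signed; external expert review pending).  No named facts, no sorries, no definitions; standard axioms.

This is the input `(PC)` of the FK hull-port programme (bschramm/FK-Q2.md §12.4): the sign of the "cross term" in the SECOND Bernstein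
deformation that proves hp-7's Lemma `Δ_N` for the random-cluster measure (FK-Q2 §12.2).  For `φ = rcMeasureW w q ∅`, `q ≥ 1`, a vertex `y`,
an avoided vertex set `T`, and two pairs `e = s(a,b)`, `f = s(c,d)` each having an endpoint in `T` (`a, c ∈ T`, `a ≠ b`, `c ≠ d`), with
`D = {C_y ∩ T = ∅}`:
  `φ(D ∩ {e open}) · φ(D ∩ {f open}) ≤ φ(D) · φ(D ∩ {e open} ∩ {f open})`,
i.e. `Cov_{φ(·|D)}(ω_e, ω_f) ≥ 0`: conditionally on the cluster of `y` avoiding `T`, two exits of `T` are still positively correlated.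
(The conditioned measure `φ(·|D)` is not an FKG-lattice measure, so this is not plain FKG.)  ONE LINE from van den Berg–Häggström–Kahn's
Theorem 2.1 for `φ_{𝐩,q}` (`BHK2006_twoSetConditionalAssociation_rc` with `S = {y}`, `T`, and the two functions `F = −1{e ∈ C_T}`,
`G = −1{f ∈ C_T}`, constant in `C_S` and antitone in `C_T`; `1{e ∈ C_T} = ω_e` for a pair at a vertex of `T`,
`FK.mem_biUnion_openEdgeCluster_iff`).  Used with `T = {s} ∪ X` (Lemma `Δ_N`, exits of the avoided set `X`) and `T = S ∪ Y` (Lemma `Δ_N^S`).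
[cite: VandenbergHaggstromKahn2005, Thm. 2.1 (p. 9)] [cite: Grimmett2006, §1.4 eq. (1.20) (p. 15)]
-/

noncomputable section

namespace Summit.CriticalPhenomena.PercolationContinuityZ3.Theorems.FK

open MeasureTheory Set
open Literature.Probability.LatticeModels
open Literature.Probability.Percolation Literature.Probability.Percolation.KNPreFKG
open scoped Classical

variable {V : Type*} [Fintype V]

/-- **Two exits of an avoided set are positively correlated given avoidance** (`φ_{𝐩,q}`, `q ≥ 1`): for `a, c ∈ T`, `a ≠ b`, `c ≠ d`,
`D = {C_y ∩ T = ∅}`:  `φ(D ∩ {s(a,b) open})·φ(D ∩ {s(c,d) open}) ≤ φ(D)·φ(D ∩ {s(a,b) open} ∩ {s(c,d) open})`.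
[cite: VandenbergHaggstromKahn2005, Thm. 2.1 (p. 9)] -/
theorem exitPair_posCorrelation_rc (w : Sym2 V → unitInterval) {q : ℝ} (hq : 1 ≤ q) (y : V) (T : Set V)
    {a b c d : V} (haT : a ∈ T) (hab : a ≠ b) (hcT : c ∈ T) (hcd : c ≠ d) :
    (rcMeasureW w q ∅).real ({ω : BondConfig V | ∀ t ∈ T, ¬ (openGraph ω).Reachable y t} ∩ {ω | s(a, b) ∈ ω}) *
        (rcMeasureW w q ∅).real ({ω : BondConfig V | ∀ t ∈ T, ¬ (openGraph ω).Reachable y t} ∩ {ω | s(c, d) ∈ ω}) ≤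
      (rcMeasureW w q ∅).real {ω : BondConfig V | ∀ t ∈ T, ¬ (openGraph ω).Reachable y t} *
        (rcMeasureW w q ∅).real ({ω : BondConfig V | ∀ t ∈ T, ¬ (openGraph ω).Reachable y t} ∩ {ω | s(a, b) ∈ ω} ∩
          {ω | s(c, d) ∈ ω}) := by
  have hq0 : 0 < q := one_pos.trans_le hq
  haveI := isProbabilityMeasure_rcMeasureW w hq0 (∅ : Set V)
  set φ := rcMeasureW w q ∅ with hφ
  set D : Set (BondConfig V) := {ω | ∀ t ∈ T, ¬ (openGraph ω).Reachable y t} with hD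
  set Oe : Set (BondConfig V) := {ω | s(a, b) ∈ ω} with hOe
  set Of : Set (BondConfig V) := {ω | s(c, d) ∈ ω} with hOf
  have hDset : {ω : BondConfig V | ∀ s' ∈ ({y} : Set V), ∀ t ∈ T, ¬ (openGraph ω).Reachable s' t} = D := by
    ext ω; simp [hD]
  -- the two test functions of `C_T`: minus the indicator that the pair belongs to the cluster
  set Fe : Set (Sym2 V) → ℝ := fun C => -(({C : Set (Sym2 V) | s(a, b) ∈ C} : Set (Set (Sym2 V))).indicator 1 C) with hFe
  set Ff : Set (Sym2 V) → ℝ := fun C => -(({C : Set (Sym2 V) | s(c, d) ∈ C} : Set (Set (Sym2 V))).indicator 1 C) with hFf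
  have hanti : ∀ (p : Sym2 V), Antitone (fun C : Set (Sym2 V) =>
      -(({C : Set (Sym2 V) | p ∈ C} : Set (Set (Sym2 V))).indicator (1 : Set (Sym2 V) → ℝ) C)) := by
    intro p
    have hup : IsUpperSet ({C : Set (Sym2 V) | p ∈ C} : Set (Set (Sym2 V))) := by
      intro C₁ C₂ h' hC
      exact h' hC
    have hmono := KNPreFKG.monotone_indicator_one_of_isUpperSet (α := Set (Sym2 V)) hup
    intro C C' h
    exact neg_le_neg (hmono h)
  -- `1{p ∈ C_T} = ω_p` for a pair `p` at a vertex of `T`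
  have hind : ∀ {a' b' : V}, a' ∈ T → a' ≠ b' → ∀ ω : BondConfig V,
      ({C : Set (Sym2 V) | s(a', b') ∈ C} : Set (Set (Sym2 V))).indicator (1 : Set (Sym2 V) → ℝ) (⋃ t ∈ T, openEdgeCluster ω t) =
        ({ω : BondConfig V | s(a', b') ∈ ω} : Set (BondConfig V)).indicator (1 : BondConfig V → ℝ) ω := by
    intro a' b' ha' hab' ω
    have hiff := mem_biUnion_openEdgeCluster_iff (T := T) ha' hab' ω
    by_cases ho : s(a', b') ∈ ω
    · rw [Set.indicator_of_mem (show (⋃ t ∈ T, openEdgeCluster ω t) ∈ {C : Set (Sym2 V) | s(a', b') ∈ C} from hiff.2 ho),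
        Set.indicator_of_mem (show ω ∈ ({ω : BondConfig V | s(a', b') ∈ ω} : Set (BondConfig V)) from ho)]
      rfl
    · rw [Set.indicator_of_notMem (show (⋃ t ∈ T, openEdgeCluster ω t) ∉ {C : Set (Sym2 V) | s(a', b') ∈ C} from
          fun h => ho (hiff.1 h)),
        Set.indicator_of_notMem (show ω ∉ ({ω : BondConfig V | s(a', b') ∈ ω} : Set (BondConfig V)) from ho)]
  have hBHK := BHK2006_twoSetConditionalAssociation_rc w hq ({y} : Set V) T (fun _ C => Fe C) (fun _ C => Ff C)
    (fun _ => monotone_const) (fun _ => hanti _) (fun _ => monotone_const) (fun _ => hanti _)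
  simp only [hFe, hFf, hind haT hab, hind hcT hcd, hDset] at hBHK
  -- evaluate the three integrals
  have h1 : ∫ ω in D, -Oe.indicator (1 : BondConfig V → ℝ) ω ∂φ = -φ.real (D ∩ Oe) := by
    rw [integral_neg, setIntegral_indicator_one_eq]
  have h2 : ∫ ω in D, -Of.indicator (1 : BondConfig V → ℝ) ω ∂φ = -φ.real (D ∩ Of) := by
    rw [integral_neg, setIntegral_indicator_one_eq]
  have h3 : ∫ ω in D, -Oe.indicator (1 : BondConfig V → ℝ) ω * -Of.indicator (1 : BondConfig V → ℝ) ω ∂φ =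
      φ.real (D ∩ Oe ∩ Of) := by
    have e1 : (fun ω => -Oe.indicator (1 : BondConfig V → ℝ) ω * -Of.indicator (1 : BondConfig V → ℝ) ω) =
        fun ω => Oe.indicator (1 : BondConfig V → ℝ) ω * Of.indicator (1 : BondConfig V → ℝ) ω := by
      funext ω; ring
    rw [e1, setIntegral_mul_indicator_one φ D Of, setIntegral_indicator_one_eq]
    congr 1
    ext ω; simp only [mem_inter_iff]; tauto
  rw [h1, h2, h3] at hBHK
  have e2 : -φ.real (D ∩ Oe) * -φ.real (D ∩ Of) = φ.real (D ∩ Oe) * φ.real (D ∩ Of) := by ring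
  rw [e2] at hBHK
  exact hBHK

end Summit.CriticalPhenomena.PercolationContinuityZ3.Theorems.FK

end
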